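import Literature.MathematicalPhysics.QuantumFieldTheory.Balaban1983to89.B5G183FreeRowSum
import Literature.MathematicalPhysics.QuantumFieldTheory.Balaban1983to89.B4Sect5Torus

/-!
# `Balaban1983to89.B5Eq129CoshWeightFactorLetters` — T. Bałaban, *Propagators and renormalization transformations for lattice gauge theories. I*,
# Commun. Math. Phys. **95** (1984) 17–40 [Balaban1984PropagatorsI] p. 36 (exponential weights `e^{⟨q,x⟩}`, «q ∈ R^d sufficiently small») and Prop. 1.2
# (1.110) p. 35, with [Balaban1985BackgroundPropagators] Thm 3.1 (3.42) p. 397 (`e^{−δ₀d(y,y′)}`): **THE ONE-FACTOR LETTERS OF THE PRODUCT `cosh` WEIGHT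
# `W_c(y) = Π_μ cosh(a·dist(c_μ − y_μ, N_μℤ))` — (1) each factor is a one-dimensional supersolution factor ON `ℤ∕N_μ` WITH AN ARBITRARY CENTRE:
# `cosh(a·d(c − (y+1))) + cosh(a·d(c − (y−1))) ≤ 2cosh a·cosh(a·d(c − y))`; (2) the factorisation `W_c = (ν-factor)·Π_{μ≠ν}(…)`; (3) the distance
# dictionary `d(0 − s) = dist(s, N_νℤ) = min(s, N_ν − s)`; (4) the OFF-SLICE SHIFT `cosh(a·d(u + v)) ≤ e^{a·d(u)}·cosh(a·d(v))` (`a ≥ 0`), read on a factor as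
# `cosh(a·d(c − y)) ≤ e^{a·min(y, N−y)}·cosh(a·d(c))`** — the inputs that turn the abstract weight hypotheses of the WEIGHTED ∇-row (P-J-1b) of the pub-balaban
# NE9 chain's storey J (row L13; `B5Eq129FreeResolventWeightedMarginal` §3 `prod_weight_transverse_defect` ∕ `B5Eq129FreeResolventWeightedGradientRow`) into
# statements about the OWNER's weight of `B5Eq129CoshSupersolution`, for EVERY centre `c` (t4-ne9-idea-1 g129's `transverse_weight_supersolution` §J3 and
# `cosh_circDist_shift_le` §J8, Mathlib-only scratch under FREEZE (0) — here in the tree's `circAbs` vocabulary with unequal periods; credit theirs)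

statement-level skeleton of published theorems with citation tags; proofs where landed; nothing here is a claim about the Yang–Mills mass gap

CITATION HEADER (lean-in-tree rule).  Audit cell `pub-balaban`, sub-cell `t4`, BINDER row NE9; filed by NE9 crux-team LEAF PROVER 05
(`b2b-balaban-t4-ne9-formalise-leaf-05`, gen 81).  OBJECT: the product `cosh` weight of [Balaban1984PropagatorsI] p. 36 EXACTLY as written out in the OWNER's
`B5Eq129CoshSupersolution` (`Π_μ Real.cosh (a * circAbs (N μ) ((c μ − y μ).val))`, `B4TorusKernel.MultiPeriod.circAbs`; no `def`).  CONTENT: [folklore]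
(`cosh` addition formulae, the triangle inequality `B4Sect5Torus.circAbs_add_le` and the symmetry `circAbs_neg` of the torus distance, `B5G183FreeRowSum.cosh_circAbs_step`
USED BY NAME — credit pv15 ∕ the OWNER).  Mathematics of (4): t4-ne9-idea-1 g129 `t4/ideate/NE9/lens1-g129/lean/PJ1Bcycle_g129.NOT-TO-FILE.lean` §J8 l.1880–1930
(credit).  Nothing of print is asserted.

WHAT IS PROVED (sorry-free; proof lane — 0 `def`).
* §1 **`cosh_factor_step`** — `cosh(a·d((c − (y+1)).val)) + cosh(a·d((c − (y−1)).val)) ≤ 2cosh a·cosh(a·d((c − y).val))` on `ZMod n`, ANY centre `c`: VERBATIM the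
  one-factor binder `hst` of `B5Eq129FreeResolventWeightedMarginal.prod_weight_transverse_defect` at `ψ_μ(y) = cosh(a_μ·circAbs(N μ)((c μ − y).val))` (its `hpos` is
  `Real.cosh_pos`); `cosh_factor_pos`, `one_le_cosh_factor`.
* §2 **`weight_eq_factor_mul_transverse`** — `W_c(y) = cosh(a·d((c ν − y ν).val))·Π_{μ ∈ univ.erase ν} cosh(a·d((c μ − y μ).val))` (the ν-free product is the
  transverse weight `Φ` of P-J-1b); `transverse_le_weight` (`Φ ≤ W_c`, each factor `≥ 1`).
* §3 **`circAbs_val_eq_min`** — `circAbs n (s.val) = min(s.val, n − s.val)`; **`circAbs_neg_val`** — `circAbs n ((−s).val) = circAbs n (s.val)`; hence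
  **`cosh_factor_centre_zero`** — `cosh(a·d((0 − s).val)) = cosh(a·min(s.val, n − s.val))`: the ν-factor centred ON the source slice is the longitudinal weight
  `φ(min(x_ν, N_ν − x_ν))`, `φ = cosh(a·)`, of `B5Eq129FreeResolventWeightedGradientRow.weighted_sum_abs_sub_le_cosh` ((W-0)).
* §4 **`cosh_circAbs_add_le`** — `cosh(a·d(u + v)) ≤ exp(a·d(u))·cosh(a·d(v))` (`a ≥ 0`, `u v : ℤ`); **`cosh_factor_le_exp_mul_centre`** —
  `cosh(a·d((c − y).val)) ≤ exp(a·min(y.val, n − y.val))·cosh(a·d((c − 0).val))`: an OFF-SLICE centre costs the factor's value AT THE SOURCE and turns the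
  longitudinal weight into `φ = exp(a·)` ((W-1)∕(W-1′)); `exp_nat_monotone`, the `φ`-binders of `weighted_sum_abs_sub_le` at `φ = exp(a·)`.
HONEST SCOPE.  Letters about a weight, no kernel: the junction with (P-J-1b) (`Σ_x W_c(x)|k(x−e_ν) − k(x)| ≤ W_c(0)·[(1 + e^a)G(0) + 2sinh a·Σ_j e^{aj}G(j)]`) is a
separate file behind `B5Eq129FreeResolventWeightedGradientRow`.  ONE input of ONE letter of ONE un-opened storey (J) of row L13; NOT the ∇-line of (3.42), NOT
Tier P, NOT NE9 (cell pub-balaban: NE9 NOT PRINTED ∕ NOT PROVED; «NE9 ⇐ the named binders»; row WALLED ON A MODEL (O-NE9-1; #5 UNRULED); spine PROVED 0∕9;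
rung (B)+1 finite T⁴ — NOT infinite volume, NOT mass gap, NOT BetaPertH, NOT Clay).  HONEST DEPENDENCY: continuum YM on T⁴ ⇐ BetaPertH ∧ nine spine estimates
(0/9 proved); BetaPertH ⇐ (D1) ∧ (D4) ∧ CAP+tail; G-an2-4 gates asym, D1 and NE2/3/4.  NEW file importing `B5G183FreeRowSum` and `B4Sect5Torus` only; nothing
modified.  Net new unproved facts: 0.
-/

noncomputable section

open scoped BigOperators

namespace Literature.MathematicalPhysics.QuantumFieldTheory.Balaban1983to89.B5Eq129CoshWeightFactorLetters

open B5Prop11Plancherel (Tor)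
open B4TorusKernel.MultiPeriod (circAbs circAbs_nonneg circAbs_add_mul)
open B4Sect5Torus (circAbs_add_le circAbs_neg circAbs_zero)
open B5G183FreeRowSum (cosh_circAbs_step circAbs_val_eq)

/-! ## §1 One factor of the product weight is a one-dimensional supersolution factor, for every centre -/

section OneFactor

variable {n : ℕ} [NeZero n]

/-- **THE ONE-FACTOR STEP ON `ℤ∕n` WITH AN ARBITRARY CENTRE `c`**:
`cosh(a·d((c − (y+1)).val)) + cosh(a·d((c − (y−1)).val)) ≤ 2cosh a·cosh(a·d((c − y).val))`, `d = circAbs n` — VERBATIM the binder `hst` of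
`B5Eq129FreeResolventWeightedMarginal.prod_weight_transverse_defect` at `ψ(y) = cosh(a·circAbs n ((c − y).val))` (pv15's `cosh_circAbs_step` after the
representative bookkeeping `circAbs_val_eq`; the OWNER's `weight_stencil'` does the same inside a `d`-fold product). [folklore]
[cite: Balaban1984PropagatorsI, p.36, (1.110) p.35] -/
theorem cosh_factor_step (a : ℝ) (c y : ZMod n) :
    Real.cosh (a * (circAbs n ((c - (y + 1) : ZMod n).val) : ℝ)) + Real.cosh (a * (circAbs n ((c - (y - 1) : ZMod n).val) : ℝ))
      ≤ 2 * Real.cosh a * Real.cosh (a * (circAbs n ((c - y : ZMod n).val) : ℝ)) := by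
  have hP : 1 ≤ n := Nat.one_le_iff_ne_zero.mpr (NeZero.ne _)
  set z : ℤ := (((c - y : ZMod n).val : ℕ) : ℤ) with hz
  have hzc : ((z : ℤ) : ZMod n) = c - y := by
    rw [hz, Int.cast_natCast, ZMod.natCast_zmod_val]
  have e1 : circAbs n (((c - (y + 1) : ZMod n).val : ℕ) : ℤ) = circAbs n (z - 1) :=
    circAbs_val_eq _ _ (by push_cast; rw [hzc]; ring)
  have e2 : circAbs n (((c - (y - 1) : ZMod n).val : ℕ) : ℤ) = circAbs n (z + 1) :=
    circAbs_val_eq _ _ (by push_cast; rw [hzc]; ring)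
  rw [e1, e2, add_comm]
  exact cosh_circAbs_step hP a z

omit [NeZero n] in
/-- each factor is positive (the binder `hpos` of `prod_weight_transverse_defect` is `Real.cosh_pos`). [folklore] [cite: Balaban1984PropagatorsI, p.36] -/
theorem cosh_factor_pos (a : ℝ) (c y : ZMod n) : 0 < Real.cosh (a * (circAbs n ((c - y : ZMod n).val) : ℝ)) :=
  Real.cosh_pos _

omit [NeZero n] in
/-- each factor is `≥ 1`. [folklore] [cite: Balaban1984PropagatorsI, p.36] -/
theorem one_le_cosh_factor (a : ℝ) (c y : ZMod n) : 1 ≤ Real.cosh (a * (circAbs n ((c - y : ZMod n).val) : ℝ)) :=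
  Real.one_le_cosh _

end OneFactor

/-! ## §2 The factorisation of the OWNER's weight into its ν-factor and the ν-free (transverse) product -/

section Factorisation

variable {d : ℕ} (N : Fin d → ℕ)

/-- **`W_c(y) = (ν-factor)·(transverse weight)`**: `Π_μ cosh(a·d((c μ − y μ).val)) = cosh(a·d((c ν − y ν).val))·Π_{μ ∈ univ.erase ν} cosh(a·d((c μ − y μ).val))` —
the ν-free product is the transverse weight `Φ` of `B5Eq129FreeResolventWeightedMarginal` §3 ∕ `B5Eq129FreeResolventWeightedGradientRow`. [folklore]
[cite: Balaban1984PropagatorsI, p.36] -/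
theorem weight_eq_factor_mul_transverse (a : ℝ) (c y : Tor N) (ν : Fin d) :
    ∏ μ, Real.cosh (a * (circAbs (N μ) ((c μ - y μ : ZMod (N μ)).val) : ℝ)) =
      Real.cosh (a * (circAbs (N ν) ((c ν - y ν : ZMod (N ν)).val) : ℝ)) *
        ∏ μ ∈ Finset.univ.erase ν, Real.cosh (a * (circAbs (N μ) ((c μ - y μ : ZMod (N μ)).val) : ℝ)) :=
  (Finset.mul_prod_erase Finset.univ (fun μ => Real.cosh (a * (circAbs (N μ) ((c μ - y μ : ZMod (N μ)).val) : ℝ)))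
    (Finset.mem_univ ν)).symm

/-- the transverse weight is dominated by the full weight (the ν-factor is `≥ 1`). [folklore] [cite: Balaban1984PropagatorsI, p.36] -/
theorem transverse_le_weight (a : ℝ) (c y : Tor N) (ν : Fin d) :
    ∏ μ ∈ Finset.univ.erase ν, Real.cosh (a * (circAbs (N μ) ((c μ - y μ : ZMod (N μ)).val) : ℝ)) ≤
      ∏ μ, Real.cosh (a * (circAbs (N μ) ((c μ - y μ : ZMod (N μ)).val) : ℝ)) := by
  rw [weight_eq_factor_mul_transverse N a c y ν]
  exact le_mul_of_one_le_left (Finset.prod_nonneg fun μ _ => (Real.cosh_pos _).le) (Real.one_le_cosh _)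

/-- the transverse weight is positive. [folklore] [cite: Balaban1984PropagatorsI, p.36] -/
theorem transverse_pos (a : ℝ) (c y : Tor N) (ν : Fin d) :
    0 < ∏ μ ∈ Finset.univ.erase ν, Real.cosh (a * (circAbs (N μ) ((c μ - y μ : ZMod (N μ)).val) : ℝ)) :=
  Finset.prod_pos fun _ _ => Real.cosh_pos _

end Factorisation

/-! ## §3 The distance dictionary: `circAbs` of a canonical representative is the cycle distance `min(s, n − s)` -/

section Dictionary

variable {n : ℕ} [NeZero n]

/-- `circAbs n (s.val) = min(s.val, n − s.val)` (the representative `s.val ∈ [0, n)` needs no reduction): the torus distance of [B5′] p. 36 l. 20–23 read on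
canonical representatives. [folklore] [cite: Balaban1984PropagatorsI, p.36 l.20–23, dictionary] -/
theorem circAbs_val_eq_min (s : ZMod n) : circAbs n ((s.val : ℕ) : ℤ) = ((min s.val (n - s.val) : ℕ) : ℤ) := by
  have hs : s.val < n := ZMod.val_lt s
  have hmod : ((s.val : ℕ) : ℤ) % (n : ℤ) = s.val := Int.emod_eq_of_lt (by positivity) (by exact_mod_cast hs)
  unfold circAbs
  rw [hmod, Nat.cast_min, Nat.cast_sub hs.le]

/-- `circAbs n ((−s).val) = circAbs n (s.val)` (the torus distance is symmetric). [folklore] [cite: Balaban1984PropagatorsI, p.36 l.20–23, dictionary] -/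
theorem circAbs_neg_val (s : ZMod n) : circAbs n (((-s : ZMod n).val : ℕ) : ℤ) = circAbs n ((s.val : ℕ) : ℤ) := by
  have hP : 1 ≤ n := Nat.one_le_iff_ne_zero.mpr (NeZero.ne _)
  rw [circAbs_val_eq (-s) (-((s.val : ℕ) : ℤ)) (by push_cast; rw [ZMod.natCast_zmod_val]), circAbs_neg hP]

/-- **THE ν-FACTOR CENTRED ON THE SOURCE SLICE IS THE `cosh` LONGITUDINAL WEIGHT OF (W-0)**:
`cosh(a·circAbs n ((0 − s).val)) = cosh(a·min(s.val, n − s.val))` — the weight `φ(min(x_ν, N_ν − x_ν))`, `φ = cosh(a·)`, of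
`B5Eq129FreeResolventWeightedGradientRow.weighted_sum_abs_sub_le_cosh`. [folklore] [cite: Balaban1984PropagatorsI, p.36] -/
theorem cosh_factor_centre_zero (a : ℝ) (s : ZMod n) :
    Real.cosh (a * (circAbs n ((0 - s : ZMod n).val) : ℝ)) = Real.cosh (a * ((min s.val (n - s.val) : ℕ) : ℝ)) := by
  rw [zero_sub, circAbs_neg_val, circAbs_val_eq_min]
  norm_cast

end Dictionary

/-! ## §4 The off-slice shift: a centre off the source slice costs the factor's value at the source and an `exp` longitudinal weight -/

section Shift

/-- **THE OFF-SLICE SHIFT** (t4-ne9-idea-1 g129's `cosh_circDist_shift_le`): for `a ≥ 0` and `u v : ℤ`,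
`cosh(a·d(u + v)) ≤ exp(a·d(u))·cosh(a·d(v))`, `d = circAbs n` — triangle inequality for the torus distance, monotonicity of `cosh`, and
`cosh(p + q) = cosh p·cosh q + sinh p·sinh q ≤ (cosh p + sinh p)·cosh q = e^p·cosh q` for `p ≥ 0`. [folklore] [cite: Balaban1984PropagatorsI, p.36] -/
theorem cosh_circAbs_add_le {n : ℕ} (hn : 1 ≤ n) {a : ℝ} (ha : 0 ≤ a) (u v : ℤ) :
    Real.cosh (a * (circAbs n (u + v) : ℝ)) ≤ Real.exp (a * (circAbs n u : ℝ)) * Real.cosh (a * (circAbs n v : ℝ)) := by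
  have hu : (0 : ℝ) ≤ circAbs n u := by exact_mod_cast circAbs_nonneg hn u
  have hv : (0 : ℝ) ≤ circAbs n v := by exact_mod_cast circAbs_nonneg hn v
  have huv : (0 : ℝ) ≤ circAbs n (u + v) := by exact_mod_cast circAbs_nonneg hn (u + v)
  have htri : ((circAbs n (u + v) : ℤ) : ℝ) ≤ circAbs n u + circAbs n v := by exact_mod_cast circAbs_add_le hn u v
  have hp : 0 ≤ a * circAbs n u := mul_nonneg ha hu
  have hq : 0 ≤ a * circAbs n v := mul_nonneg ha hv
  calc Real.cosh (a * (circAbs n (u + v) : ℝ))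
      ≤ Real.cosh (a * circAbs n u + a * circAbs n v) := by
        rw [Real.cosh_le_cosh, abs_of_nonneg (mul_nonneg ha huv), abs_of_nonneg (add_nonneg hp hq), ← mul_add]
        exact mul_le_mul_of_nonneg_left htri ha
    _ = Real.cosh (a * circAbs n u) * Real.cosh (a * circAbs n v) + Real.sinh (a * circAbs n u) * Real.sinh (a * circAbs n v) :=
        Real.cosh_add _ _
    _ ≤ Real.cosh (a * circAbs n u) * Real.cosh (a * circAbs n v) + Real.sinh (a * circAbs n u) * Real.cosh (a * circAbs n v) := by
        have h1 : Real.sinh (a * circAbs n v) ≤ Real.cosh (a * circAbs n v) := (Real.sinh_lt_cosh _).le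
        have h2 : 0 ≤ Real.sinh (a * circAbs n u) := Real.sinh_nonneg_iff.mpr hp
        nlinarith
    _ = Real.exp (a * (circAbs n u : ℝ)) * Real.cosh (a * (circAbs n v : ℝ)) := by
        rw [← Real.cosh_add_sinh (a * (circAbs n u : ℝ))]
        ring

variable {n : ℕ} [NeZero n]

/-- **ONE FACTOR WITH AN OFF-SLICE CENTRE** (the (W-1′) reading): for `a ≥ 0` and `c y : ZMod n`,
`cosh(a·d((c − y).val)) ≤ exp(a·min(y.val, n − y.val))·cosh(a·d((c − 0).val))` — the factor at `y` is at most the `exp` longitudinal weight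
`φ(min(y, n − y))`, `φ = exp(a·)` (the `φ` of `B5Eq129FreeResolventWeightedGradientRow.weighted_sum_abs_sub_le`), times the factor's value AT THE SOURCE `0`.
[folklore] [cite: Balaban1984PropagatorsI, p.36] -/
theorem cosh_factor_le_exp_mul_centre {a : ℝ} (ha : 0 ≤ a) (c y : ZMod n) :
    Real.cosh (a * (circAbs n ((c - y : ZMod n).val) : ℝ)) ≤
      Real.exp (a * ((min y.val (n - y.val) : ℕ) : ℝ)) * Real.cosh (a * (circAbs n ((c - 0 : ZMod n).val) : ℝ)) := by
  have hP : 1 ≤ n := Nat.one_le_iff_ne_zero.mpr (NeZero.ne _)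
  have e1 : circAbs n (((c - y : ZMod n).val : ℕ) : ℤ) = circAbs n (-((y.val : ℕ) : ℤ) + ((c.val : ℕ) : ℤ)) :=
    circAbs_val_eq _ _ (by push_cast; rw [ZMod.natCast_zmod_val, ZMod.natCast_zmod_val]; ring)
  have e2 : circAbs n (((c - 0 : ZMod n).val : ℕ) : ℤ) = circAbs n ((c.val : ℕ) : ℤ) := by rw [sub_zero]
  have e3 : ((circAbs n (-((y.val : ℕ) : ℤ)) : ℤ) : ℝ) = ((min y.val (n - y.val) : ℕ) : ℝ) := by
    rw [circAbs_neg hP, circAbs_val_eq_min]; norm_cast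
  rw [e1, e2, ← e3]
  exact cosh_circAbs_add_le hP ha _ _

/-- `exp` on `ℕ·a`, `a ≥ 0`, is monotone (the `hφ` binder of `weighted_sum_abs_sub_le` at `φ = exp(a·)`, the one-sided exponential weight of [B5′] p. 36;
`hφ0` is `Real.exp_nonneg`). [folklore] [cite: Balaban1984PropagatorsI, p.36] -/
theorem exp_nat_monotone {a : ℝ} (ha : 0 ≤ a) : Monotone fun j : ℕ => Real.exp (a * j) := by
  intro i j hij
  exact Real.exp_le_exp.mpr (mul_le_mul_of_nonneg_left (by exact_mod_cast hij) ha)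

/-- the `exp` increments: `e^{a(j+1)} − e^{a(j−1)} = 2·sinh a·e^{aj}` for `1 ≤ j` (the interior coefficients of `weighted_sum_abs_sub_le` at `φ = exp(a·)`;
(W-1)). [folklore] [cite: Balaban1984PropagatorsI, p.36] -/
theorem exp_succ_sub_exp_pred {a : ℝ} {j : ℕ} (hj : 1 ≤ j) :
    Real.exp (a * ((j + 1 : ℕ) : ℝ)) - Real.exp (a * ((j - 1 : ℕ) : ℝ)) = 2 * Real.sinh a * Real.exp (a * j) := by
  rw [Nat.cast_sub hj]
  push_cast
  rw [show a * ((j : ℝ) + 1) = a * j + a by ring, show a * ((j : ℝ) - 1) = a * j - a by ring, Real.exp_add, Real.exp_sub,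
    Real.sinh_eq, Real.exp_neg]
  have h := Real.exp_pos a
  field_simp

/-- the `exp` edge coefficient: `e^{a·0} + e^{a·1} = 1 + e^a` ((W-1)). [folklore] [cite: Balaban1984PropagatorsI, p.36] -/
theorem exp_zero_add_exp_one (a : ℝ) : Real.exp (a * ((0 : ℕ) : ℝ)) + Real.exp (a * ((1 : ℕ) : ℝ)) = 1 + Real.exp a := by
  simp

end Shift

end Literature.MathematicalPhysics.QuantumFieldTheory.Balaban1983to89.B5Eq129CoshWeightFactorLetters

end
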